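import Literature.Barriers.ValiantsHypothesis.RankLiftingBarrier
import Literature.Computability.AlgebraicComplexity.BasicTensorSubspaces
import Mathlib.Data.Nat.Choose.Multinomial
import Mathlib.RingTheory.MvPowerSeries.Basic
import Mathlib.LinearAlgebra.Dimension.Constructions
import Mathlib.LinearAlgebra.FiniteDimensional.Defs
import HarnessLib

/-!
# The lifting barrier for forms (GMOW 2019, Thm. 1.16): the polynomial map, coefficient spans and
frames

Topic `Literature/Barriers/ValiantsHypothesis`; first half of the proof of `GMOW2019_thm116`
(`RankLiftingBarrier.lean`) from the numeric-to-symbolic transfer, following §5.3 of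
Garg–Makam–Oliveira–Wigderson 2019 (the assembly is `RankLiftingBarrierProofs.lean`):

1. `liftPoly`: the polynomial map `L = φ ∘ ψ : F^n → Ten(m,k)`, `ψ(β) = ℓ_β^d`, written with the
   multinomial expansion of `(∑ βᵢ xᵢ)^d` (`eval_liftPoly`); it is homogeneous of degree `d`, so
   `L(z + c)` has total degree `≤ d` (`totalDegree_aeval_liftPoly_le`).
2. `coeffVec`, `coeffSpan`: the coefficient vectors `v_{t,j,e}(s) = [z^e] p_{t,j,s}` of vectors of
   power series and the spans `𝒞_{t,j,ν} = span{v_{t,j,e} : |e| = ν}` with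
   `dim 𝒞_{t,j,ν} ≤ #{e : |e| = ν} ≤ n^ν` (Lemma 5.13).
3. `FrameIdx`, `frameOf`, `slotOf`, `liftRange`: the subspace `W = ∑_{t,μ} ⊗_j 𝒞_{t,j,μ_j}` over weak
   compositions `μ` with `∑ μ_j ≤ d` (`Comp`), realised as the range of ONE frame map
   (`BasicTensorSubspaces.frameMap`) indexed by `(t, μ, basis tuple for the slots j ≠ l(μ))`,
   `l(μ)` a slot with `μ_l` maximal (`domSlot`) — Lemmas 5.2/5.4 of the paper: every rank-one
   tensor `⊗_j v_{t,j,e_j}` with `∑ |e_j| ≤ d` lies in `W` (`rankOneTensor_coeffVec_mem_liftRange`),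
   every element of `W` has `trk ≤ #frames` (`tensorRankD_le_of_mem_liftRange`), and
   `#frames ≤ r · (d+1)^k · n^{⌊(k-1)d/k⌋}` (`card_frameIdx_le`, from `∑_{j ≠ l} μ_j ≤ ⌊(k-1)d/k⌋`,
   `sum_ne_domSlot_le`; Lemma 5.13 / Cor. 5.14).

## References

* [GargMakamOliveiraWigderson2019] A. Garg, V. Makam, R. Oliveira, A. Wigderson, *More barriers
  for rank methods, via a "numeric to symbolic" transfer*, FOCS 2019 (arXiv:1904.04299), §5
  (Lemmas 5.2, 5.4, 5.11, 5.13, Cor. 5.12, 5.14, proof of Thm. 1.16).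
-/

noncomputable section

open scoped BigOperators

namespace Literature.Barriers.ValiantsHypothesis

open Literature.Computability.AlgebraicComplexity MvPolynomial

variable {F : Type*} [Field F] {n m k : ℕ}

/-! ### Step 1: the polynomial map `L = φ ∘ ψ` -/

/-- The monomial `x^κ = ∏ᵢ xᵢ^{κᵢ}` for an exponent vector `κ : Fin n → ℕ`. [folklore] -/
def monoPow (F : Type*) [Field F] {n : ℕ} (κ : Fin n → ℕ) : MvPolynomial (Fin n) F :=
  ∏ i, X i ^ κ i

/-- `x^κ(β) = ∏ βᵢ^{κᵢ}`. [folklore] -/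
theorem eval_monoPow (κ : Fin n → ℕ) (β : Fin n → F) : eval β (monoPow F κ) = ∏ i, β i ^ κ i := by
  simp [monoPow, map_prod]

/-- `x^κ` under an algebra map: `∏ gᵢ^{κᵢ}`. [folklore] -/
theorem aeval_monoPow {A : Type*} [CommSemiring A] [Algebra F A] (g : Fin n → A) (κ : Fin n → ℕ) :
    aeval g (monoPow F κ) = ∏ i, g i ^ κ i := by
  simp [monoPow, map_prod]

/-- Multinomial expansion of a power of a linear form:
`(∑ aᵢ xᵢ)^d = ∑_{|κ| = d} binom(d; κ) a^κ x^κ`. [folklore] -/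
theorem linearForm_pow_eq_sum (a : Fin n → F) (d : ℕ) :
    linearForm a ^ d = ∑ κ ∈ (Finset.univ : Finset (Fin n)).piAntidiag d,
      ((Nat.multinomial Finset.univ κ : F) * ∏ i, a i ^ κ i) • monoPow F κ := by
  unfold linearForm
  rw [Finset.sum_pow_eq_sum_piAntidiag]
  refine Finset.sum_congr rfl fun κ _ => ?_
  rw [smul_eq_C_mul, map_mul, map_natCast, map_prod, monoPow, mul_assoc, ← Finset.prod_mul_distrib]
  congr 1
  refine Finset.prod_congr rfl fun i _ => ?_
  rw [mul_pow, C_pow]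

/-- The polynomial map `L = φ ∘ ψ` of GMOW 2019, §5.3 in coordinates: `liftPoly d φ i ∈ F[z₁,…,z_n]`
is the polynomial with `liftPoly d φ i (β) = φ(ℓ_β^d)_i` (`eval_liftPoly`), namely
`∑_{|κ|=d} binom(d;κ) φ(x^κ)_i z^κ`. [cite: GargMakamOliveiraWigderson2019, §5.3] -/
def liftPoly (d : ℕ) (φ : MvPolynomial (Fin n) F →ₗ[F] ((Fin k → Fin m) → F)) (i : Fin k → Fin m) :
    MvPolynomial (Fin n) F :=
  ∑ κ ∈ (Finset.univ : Finset (Fin n)).piAntidiag d,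
    C ((Nat.multinomial Finset.univ κ : F) * φ (monoPow F κ) i) * monoPow F κ

/-- `L(β) = φ(ℓ_β^d)` coordinatewise. [cite: GargMakamOliveiraWigderson2019, §5.3] -/
theorem eval_liftPoly (d : ℕ) (φ : MvPolynomial (Fin n) F →ₗ[F] ((Fin k → Fin m) → F))
    (i : Fin k → Fin m) (β : Fin n → F) :
    eval β (liftPoly d φ i) = φ (linearForm β ^ d) i := by
  rw [linearForm_pow_eq_sum, map_sum, Finset.sum_apply, liftPoly, map_sum]
  refine Finset.sum_congr rfl fun κ _ => ?_
  rw [map_mul, eval_C, eval_monoPow, map_smul, Pi.smul_apply, smul_eq_mul]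
  ring

/-- `L(z + c)` has total degree `≤ d` (`L` is homogeneous of degree `d`). [cite: GargMakamOliveiraWigderson2019, §5.3] -/
theorem totalDegree_aeval_liftPoly_le (d : ℕ) (φ : MvPolynomial (Fin n) F →ₗ[F] ((Fin k → Fin m) → F))
    (i : Fin k → Fin m) (c : Fin n → F) :
    (aeval (fun s : Fin n => X s + C (c s)) (liftPoly d φ i)).totalDegree ≤ d := by
  unfold liftPoly
  rw [map_sum]
  refine totalDegree_finsetSum_le fun κ hκ => ?_
  rw [map_mul, aeval_C, aeval_monoPow]
  refine (totalDegree_mul _ _).trans ?_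
  rw [show (algebraMap F (MvPolynomial (Fin n) F)) = C from rfl, totalDegree_C, zero_add]
  refine (totalDegree_finsetProd _ _).trans ?_
  have hκ' : (Finset.univ : Finset (Fin n)).sum κ = d := (Finset.mem_piAntidiag.1 hκ).1
  rw [← hκ']
  refine Finset.sum_le_sum fun s _ => ?_
  refine (totalDegree_pow _ _).trans ?_
  have h1 : (X s + C (c s) : MvPolynomial (Fin n) F).totalDegree ≤ 1 :=
    (totalDegree_add _ _).trans (max_le (totalDegree_X s).le (by rw [totalDegree_C]; exact Nat.zero_le _))
  calc κ s * (X s + C (c s) : MvPolynomial (Fin n) F).totalDegree ≤ κ s * 1 :=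
        Nat.mul_le_mul_left _ h1
    _ = κ s := mul_one _

/-- Shifted evaluation: `L(z + c)(w) = L(w + c)`. [folklore] -/
theorem eval_aeval_X_add_C (c w : Fin n → F) (P : MvPolynomial (Fin n) F) :
    eval w (aeval (fun s : Fin n => X s + C (c s)) P) = eval (w + c) P := by
  induction P using MvPolynomial.induction_on with
  | C a => simp
  | add p q hp hq => simp [hp, hq]
  | mul_X p s hp => simp [hp]

/-! ### Step 2: coefficient vectors of the power series and their spans -/

section Coeff

variable {r : ℕ} (p : Fin r → Fin k → Fin m → MvPowerSeries (Fin n) F)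

/-- The coefficient vector `v_{t,j,e} = ([z^e] p_{t,j,s})_s ∈ F^m` of the power series vector
`p_{t,j}` (GMOW 2019, §5.3: "we refer to the `p_{i,e}`'s … as coefficient vectors").
[cite: GargMakamOliveiraWigderson2019, §5.3] -/
def coeffVec (t : Fin r) (j : Fin k) (e : Fin n →₀ ℕ) : Fin m → F :=
  fun s => MvPowerSeries.coeff e (p t j s)

/-- The span `𝒞_{t,j,ν} = span{v_{t,j,e} : |e| = ν}` of the coefficient vectors of degree `ν`.
[cite: GargMakamOliveiraWigderson2019, §5.3] -/
def coeffSpan (t : Fin r) (j : Fin k) (ν : ℕ) : Submodule F (Fin m → F) :=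
  Submodule.span F (Set.range fun e : ((Finset.univ : Finset (Fin n)).finsuppAntidiag ν) =>
    coeffVec p t j e.1)

/-- `v_{t,j,e} ∈ 𝒞_{t,j,|e|}`. [cite: GargMakamOliveiraWigderson2019, §5.3] -/
theorem coeffVec_mem_coeffSpan (t : Fin r) (j : Fin k) (e : Fin n →₀ ℕ) :
    coeffVec p t j e ∈ coeffSpan p t j e.degree := by
  classical
  exact Submodule.subset_span ⟨⟨e, (mem_finsuppAntidiag_univ_iff e).2 rfl⟩, rfl⟩

/-- `dim 𝒞_{t,j,ν} ≤ #{e : |e| = ν} ≤ n^ν` (GMOW 2019, Lemma 5.13: `≤ binom(n+ν-1, ν)`).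
[cite: GargMakamOliveiraWigderson2019, Lemma 5.13] -/
theorem finrank_coeffSpan_le (t : Fin r) (j : Fin k) (ν : ℕ) :
    Module.finrank F (coeffSpan p t j ν) ≤ n ^ ν := by
  classical
  unfold coeffSpan
  refine (finrank_range_le_card _).trans ?_
  rw [Fintype.card_coe]
  exact card_finsuppAntidiag_univ_le_pow n ν

end Coeff

/-! ### Step 3: compositions, the dominant slot, and the frames -/

/-- Weak compositions `μ = (μ_j)_{j<k}` with `∑ μ_j ≤ d` (the paper's `𝒫(d,k)` has `= d`; after
the translation `z ↦ z + c` all total degrees `≤ d` occur). [cite: GargMakamOliveiraWigderson2019, §5.3] -/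
abbrev Comp (k d : ℕ) : Type := {μ : Fin k → Fin (d + 1) // ∑ j, (μ j : ℕ) ≤ d}

/-- `#𝒫 ≤ (d+1)^k`. [folklore] -/
theorem card_comp_le (k d : ℕ) : Fintype.card (Comp k d) ≤ (d + 1) ^ k := by
  refine (Fintype.card_subtype_le _).trans ?_
  rw [Fintype.card_fun, Fintype.card_fin, Fintype.card_fin]

/-- A slot `l` where `μ_l` is maximal (the paper's "`l` such that `μ_l ≥ μ_j` for all `j`").
[cite: GargMakamOliveiraWigderson2019, Lemma 5.13] -/
def domSlot [NeZero k] {d : ℕ} (μ : Fin k → Fin (d + 1)) : Fin k :=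
  Classical.choose (Finset.exists_max_image Finset.univ (fun j => (μ j : ℕ)) Finset.univ_nonempty)

/-- `μ_j ≤ μ_l`. [cite: GargMakamOliveiraWigderson2019, Lemma 5.13] -/
theorem le_domSlot [NeZero k] {d : ℕ} (μ : Fin k → Fin (d + 1)) (j : Fin k) :
    (μ j : ℕ) ≤ μ (domSlot μ) :=
  (Classical.choose_spec
    (Finset.exists_max_image Finset.univ (fun j => (μ j : ℕ)) Finset.univ_nonempty)).2 j
    (Finset.mem_univ j)

/-- **The exponent count** (GMOW 2019, Lemma 5.13 / Cor. 5.14): dropping a maximal part,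
`∑_{j ≠ l} μ_j ≤ ⌊(k-1)d/k⌋` whenever `∑_j μ_j ≤ d`. [cite: GargMakamOliveiraWigderson2019, Lemma 5.13] -/
theorem sum_ne_domSlot_le [NeZero k] {d : ℕ} (μ : Comp k d) :
    ∑ j : {j : Fin k // j ≠ domSlot μ.1}, (μ.1 j : ℕ) ≤ (k - 1) * d / k := by
  classical
  set l := domSlot μ.1 with hl
  set S := ∑ j, (μ.1 j : ℕ) with hS
  set M := (μ.1 l : ℕ) with hM
  have hSd : S ≤ d := μ.2
  have hMS : M ≤ S := by
    rw [hS, hM]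
    exact Finset.single_le_sum (f := fun j => (μ.1 j : ℕ)) (fun j _ => Nat.zero_le _)
      (Finset.mem_univ l)
  have hSkM : S ≤ k * M := by
    have := Finset.sum_le_card_nsmul (Finset.univ : Finset (Fin k)) (fun j => (μ.1 j : ℕ)) M
      fun j _ => le_domSlot μ.1 j
    simpa using this
  have hsum : ∑ j : {j : Fin k // j ≠ l}, (μ.1 j : ℕ) = S - M := by
    have h1 : ∑ j : {j : Fin k // j ≠ l}, (μ.1 j : ℕ) = ∑ j ∈ Finset.univ.erase l, (μ.1 j : ℕ) :=
      (Finset.sum_subtype (Finset.univ.erase l) (fun j => by simp) fun j => (μ.1 j : ℕ)).symm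
    have h2 := Finset.add_sum_erase Finset.univ (fun j => (μ.1 j : ℕ)) (Finset.mem_univ l)
    rw [h1]
    omega
  rw [hsum]
  have hk : 0 < k := Nat.pos_of_ne_zero (NeZero.ne k)
  rw [Nat.le_div_iff_mul_le hk]
  have h3 : (S - M) * k + S ≤ S * k := by
    calc (S - M) * k + S ≤ (S - M) * k + M * k := Nat.add_le_add_left (by linarith [mul_comm k M]) _
      _ = (S - M + M) * k := (Nat.add_mul _ _ _).symm
      _ = S * k := by rw [Nat.sub_add_cancel hMS]
  calc (S - M) * k ≤ S * k - S := Nat.le_sub_of_add_le h3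
    _ = S * (k - 1) := by rw [Nat.mul_sub_one]
    _ ≤ d * (k - 1) := Nat.mul_le_mul_right _ hSd
    _ = (k - 1) * d := Nat.mul_comm _ _

section Frames

variable [NeZero k] {r : ℕ} (p : Fin r → Fin k → Fin m → MvPowerSeries (Fin n) F) (d : ℕ)

/-- The frame index: a term `t < r`, a composition `μ`, and a basis vector of `𝒞_{t,j,μ_j}` for each
slot `j ≠ l(μ)`. [cite: GargMakamOliveiraWigderson2019, Lemma 5.4] -/
abbrev FrameIdx : Type :=
  Σ (t : Fin r), Σ (μ : Comp k d),
    ((j : {j : Fin k // j ≠ domSlot μ.1}) → Fin (Module.finrank F (coeffSpan p t j.1 (μ.1 j.1))))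

/-- The frame of an index: basis vectors in the slots `j ≠ l(μ)` (the slot `l(μ)` is free).
[cite: GargMakamOliveiraWigderson2019, Lemma 5.4] -/
def frameOf (β : FrameIdx p d) (j : Fin k) : Fin m → F :=
  if h : j = domSlot β.2.1.1 then 0
  else ((Module.finBasis F (coeffSpan p β.1 j (β.2.1.1 j)) (β.2.2 ⟨j, h⟩) :
    coeffSpan p β.1 j (β.2.1.1 j)) : Fin m → F)

/-- The free slot of an index: `l(μ)`. [cite: GargMakamOliveiraWigderson2019, Lemma 5.4] -/
def slotOf (β : FrameIdx p d) : Fin k :=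
  domSlot β.2.1.1

/-- The subspace `W = ∑_{t,μ} ⊗_j 𝒞_{t,j,μ_j}` realised as the range of the frame map.
[cite: GargMakamOliveiraWigderson2019, Lemma 5.11] -/
def liftRange : Submodule F ((Fin k → Fin m) → F) :=
  LinearMap.range (frameMap (frameOf p d) (slotOf p d))

/-- Every element of `W` has tensor rank `≤ #frames`. [cite: GargMakamOliveiraWigderson2019, Lemma 5.4] -/
theorem tensorRankD_le_of_mem_liftRange {T : (Fin k → Fin m) → F} (hT : T ∈ liftRange p d) :
    tensorRankD T ≤ Fintype.card (FrameIdx p d) := by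
  obtain ⟨w, rfl⟩ := hT
  exact tensorRankD_frameMap_le _ _ w

/-- **GMOW 2019, Lemmas 5.2/5.4 in use:** a rank-one tensor of coefficient vectors
`⊗_j v_{t,j,e_j}` with `∑_j |e_j| ≤ d` lies in `W` (expand the factors in bases of the
`𝒞_{t,j,|e_j|}`). [cite: GargMakamOliveiraWigderson2019, Lemma 5.11] -/
theorem rankOneTensor_coeffVec_mem_liftRange (t : Fin r) (E : Fin k → (Fin n →₀ ℕ))
    (hE : ∑ j, (E j).degree ≤ d) :
    rankOneTensor (fun j => coeffVec p t j (E j)) ∈ liftRange p d := by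
  classical
  have hlt : ∀ j, (E j).degree < d + 1 := fun j =>
    Nat.lt_succ_of_le ((Finset.single_le_sum (f := fun j => (E j).degree)
      (fun j _ => Nat.zero_le _) (Finset.mem_univ j)).trans hE)
  let μ : Comp k d := ⟨fun j => ⟨(E j).degree, hlt j⟩, hE⟩
  set l := domSlot μ.1 with hl
  -- basis expansion in every slot
  have hmem : ∀ j, coeffVec p t j (E j) ∈ coeffSpan p t j (μ.1 j) := fun j =>
    coeffVec_mem_coeffSpan p t j (E j)
  let b : ∀ j : Fin k, Module.Basis (Fin (Module.finrank F (coeffSpan p t j (μ.1 j)))) F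
      (coeffSpan p t j (μ.1 j)) := fun j => Module.finBasis F _
  let coef : ∀ j : Fin k, Fin (Module.finrank F (coeffSpan p t j (μ.1 j))) → F := fun j s =>
    (b j).repr ⟨_, hmem j⟩ s
  have hexp : (fun j => coeffVec p t j (E j)) =
      fun j => ∑ s, coef j s • ((b j s : coeffSpan p t j (μ.1 j)) : Fin m → F) := by
    funext j
    have h1 := (b j).sum_repr ⟨coeffVec p t j (E j), hmem j⟩
    have h2 := congrArg (fun x : coeffSpan p t j (μ.1 j) => (x : Fin m → F)) h1
    simp only [Submodule.coe_sum, Submodule.coe_smul] at h2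
    exact h2.symm
  rw [hexp, ← rankOneMultilinear_apply, MultilinearMap.map_sum (rankOneMultilinear F k m)
    (fun j s => coef j s • ((b j s : coeffSpan p t j (μ.1 j)) : Fin m → F))]
  refine Submodule.sum_mem _ fun τ _ => ?_
  rw [MultilinearMap.map_smul_univ, rankOneMultilinear_apply]
  refine Submodule.smul_mem _ _ ?_
  -- this is the frame `⟨t, μ, τ|_{j ≠ l}⟩` with its free slot filled by `b l (τ l)`
  let β : FrameIdx p d := ⟨t, μ, fun jj => τ jj.1⟩
  have key : (fun j => ((b j (τ j) : coeffSpan p t j (μ.1 j)) : Fin m → F)) =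
      Function.update (frameOf p d β) (slotOf p d β) ((b l (τ l) : coeffSpan p t l (μ.1 l)) :
        Fin m → F) := by
    funext j
    by_cases hj : j = l
    · subst hj
      simp only [slotOf, β, ← hl, Function.update_self]
    · have hj' : j ≠ slotOf p d β := hj
      rw [Function.update_of_ne hj']
      simp only [frameOf, β, ← hl, dif_neg hj, b]
  rw [key]
  exact rankOneTensor_update_mem_range_frameMap _ _ β _

/-- **The count** (GMOW 2019, Lemma 5.13 / Cor. 5.14): `#frames ≤ r · (d+1)^k · n^{⌊(k-1)d/k⌋}`
(`n ≥ 1`). [cite: GargMakamOliveiraWigderson2019, Cor. 5.14] -/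
theorem card_frameIdx_le (hn : 1 ≤ n) :
    Fintype.card (FrameIdx p d) ≤ r * ((d + 1) ^ k * n ^ ((k - 1) * d / k)) := by
  classical
  rw [Fintype.card_sigma]
  have hterm : ∀ (t : Fin r) (μ : Comp k d),
      Fintype.card ((j : {j : Fin k // j ≠ domSlot μ.1}) →
        Fin (Module.finrank F (coeffSpan p t j.1 (μ.1 j.1)))) ≤ n ^ ((k - 1) * d / k) := by
    intro t μ
    rw [Fintype.card_pi]
    calc ∏ j : {j : Fin k // j ≠ domSlot μ.1},
          Fintype.card (Fin (Module.finrank F (coeffSpan p t j.1 (μ.1 j.1))))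
        ≤ ∏ j : {j : Fin k // j ≠ domSlot μ.1}, n ^ (μ.1 j.1 : ℕ) := by
          refine Finset.prod_le_prod (fun j _ => Nat.zero_le _) fun j _ => ?_
          rw [Fintype.card_fin]
          exact finrank_coeffSpan_le p t j.1 _
      _ = n ^ ∑ j : {j : Fin k // j ≠ domSlot μ.1}, (μ.1 j.1 : ℕ) := Finset.prod_pow_eq_pow_sum _ _ _
      _ ≤ n ^ ((k - 1) * d / k) := Nat.pow_le_pow_right hn (sum_ne_domSlot_le μ)
  calc ∑ t : Fin r, Fintype.card (Σ (μ : Comp k d), ((j : {j : Fin k // j ≠ domSlot μ.1}) →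
          Fin (Module.finrank F (coeffSpan p t j.1 (μ.1 j.1)))))
      ≤ ∑ _t : Fin r, (d + 1) ^ k * n ^ ((k - 1) * d / k) := by
        refine Finset.sum_le_sum fun t _ => ?_
        rw [Fintype.card_sigma]
        calc _ ≤ ∑ _μ : Comp k d, n ^ ((k - 1) * d / k) := Finset.sum_le_sum fun μ _ => hterm t μ
          _ = Fintype.card (Comp k d) * n ^ ((k - 1) * d / k) := by
            rw [Finset.sum_const, smul_eq_mul, Finset.card_univ]
          _ ≤ (d + 1) ^ k * n ^ ((k - 1) * d / k) :=
            Nat.mul_le_mul_right _ (card_comp_le k d)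
    _ = r * ((d + 1) ^ k * n ^ ((k - 1) * d / k)) := by
        rw [Finset.sum_const, smul_eq_mul, Finset.card_univ, Fintype.card_fin]

end Frames

end Literature.Barriers.ValiantsHypothesis
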